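import Summits.HubbardSuperconductivity.HubbardSuperconductivity.Theorems.BalabanIRBirGappedPhaseReductionExplicitStiffness
import HarnessLib

/-!
# Route BalabanIR — crux 4 `BirGappedPhaseReduction` / 4R (items `stmt-HubbardSuperconductivity-2082`, `…-14846`):
# the zero-mode weight RELATIVE TO THE ALIGNED HISTORY — an extensive suppression factor

`…ExplicitStiffness.norm_trace_prod_gibbsWeight_bdgTorus_phase_le_explicit` bounds the Fock weight of
a zero-mode pair-phase history of the torus reference by `|e^{…}| ∏_k (2 + 2cosh_k · e^{-(κ₀(k)/2)S(θ)})`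
and `…ClosedForm.trace_prod_gibbsWeight_bdgTorus_const_phase` computes the aligned history
`e^{…} ∏_k (2 + 2cosh_k)`, `cosh_k = cosh((2n+2)aE_k)`. This file divides the two:

* `prod_le_prod_mul_pow_card` — if `0 ≤ F_k ≤ A_k` for all `k` and `F_k ≤ A_k · t` on a set `G`,
  then `∏ F ≤ (∏ A) · t^{|G|}` (generic);
* `two_add_two_mul_mul_le`, `two_add_two_mul_mul_le_mul_add` — per mode,
  `2 + 2C·x ≤ 2 + 2C` and `2 + 2C·x ≤ (2 + 2C)(x + 1/(1+C))` (`0 ≤ x ≤ 1 ≤ C`);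
  `one_div_one_add_cosh_le` — `1/(1 + cosh y) ≤ 2e^{-|y|}`;
* **`norm_trace_prod_gibbsWeight_bdgTorus_phase_le_aligned_mul_pow`** — for ANY finite set `G` of
  modes on which the explicit stiffness is at least `κ_G` and the dispersion at least `E_G`,
  `‖W(θ)‖ ≤ ‖W(0)‖ · (e^{-(κ_G/2)·S(θ)} + 2e^{-(2n+2)|a|E_G})^{|G|}`,
  `W(θ) = Tr ∏_t e^{-aH_BdG(η, e^{iθ_t}Δ, μ)}` over `2n+2` slices, `W(0)` the aligned history,
  `S(θ) = Σ_t (1 - cos(θ_{t+1} - θ_t))`: once the number of slices makes the pair-doublet leakage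
  `2e^{-(2n+2)|a|E_G}` small, a misaligned zero-mode history is suppressed by
  `≈ e^{-|G|·(κ_G/2)·S(θ)}` — EXTENSIVE in the number `|G|` of gapped modes (for the route's d+id
  reference `|G| ≳ L²`, companion file).

`Theses`-free, no definitions; `--supports` the crux. [folklore]
-/

noncomputable section

namespace Summit.HubbardSuperconductivity.HubbardSuperconductivity.Theorems

namespace BirBdG

open Matrix NormedSpace Literature.Probability.LatticeModels Literature.MathematicalPhysics.QuantumLattice
open scoped ComplexConjugate ComplexOrder

section Ratio

/-- **Product splitting.** If `0 ≤ F_k ≤ A_k` on `s` and `F_k ≤ A_k·t` on `G ⊆ s` (`t ≥ 0`), then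
`∏_s F ≤ (∏_s A)·t^{|G|}` (any real `t`). [folklore] -/
theorem prod_le_prod_mul_pow_card {ι : Type*} [DecidableEq ι] (s G : Finset ι) (hG : G ⊆ s)
    (F A : ι → ℝ) (hF0 : ∀ k ∈ s, 0 ≤ F k) (hFA : ∀ k ∈ s, F k ≤ A k) {t : ℝ}
    (hG' : ∀ k ∈ G, F k ≤ A k * t) :
    ∏ k ∈ s, F k ≤ (∏ k ∈ s, A k) * t ^ G.card := by
  have hA0 : ∀ k ∈ s, 0 ≤ A k := fun k hk => (hF0 k hk).trans (hFA k hk)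
  calc ∏ k ∈ s, F k ≤ ∏ k ∈ s, (A k * if k ∈ G then t else 1) := by
        refine Finset.prod_le_prod hF0 fun k hk => ?_
        split_ifs with h
        · exact hG' k h
        · rw [mul_one]; exact hFA k hk
    _ = (∏ k ∈ s, A k) * t ^ G.card := by
        rw [Finset.prod_mul_distrib, Finset.prod_ite, Finset.prod_const_one, mul_one,
          Finset.prod_const]
        congr 2
        rw [Finset.filter_mem_eq_inter, Finset.inter_eq_right.mpr hG]

/-- Per mode: `2 + 2C·x ≤ 2 + 2C` for `x ≤ 1`, `0 ≤ C`. [folklore] -/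
theorem two_add_two_mul_mul_le {C x : ℝ} (hC : 0 ≤ C) (hx : x ≤ 1) : 2 + 2 * C * x ≤ 2 + 2 * C := by
  nlinarith

/-- Per mode: `2 + 2C·x ≤ (2 + 2C)·(x + 1/(1+C))` for `0 ≤ x`, `0 ≤ C` — the ratio to the
aligned factor is `p + (1-p)x ≤ x + p`, `p = 1/(1+C)`. [folklore] -/
theorem two_add_two_mul_mul_le_mul_add {C x : ℝ} (hC : 0 ≤ C) (hx : 0 ≤ x) :
    2 + 2 * C * x ≤ (2 + 2 * C) * (x + 1 / (1 + C)) := by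
  have h1 : 0 < 1 + C := by linarith
  rw [mul_add, mul_one_div, show (2 + 2 * C) / (1 + C) = 2 by rw [div_eq_iff h1.ne']; ring]
  nlinarith

/-- `1/(1 + cosh y) ≤ 2e^{-|y|}`. [folklore] -/
theorem one_div_one_add_cosh_le (y : ℝ) : 1 / (1 + Real.cosh y) ≤ 2 * Real.exp (-|y|) := by
  have hc : Real.exp |y| ≤ 2 * Real.cosh y := by
    rw [← Real.cosh_abs, Real.cosh_eq]
    have := Real.exp_pos (-|y|)
    linarith
  have hpos : 0 < 1 + Real.cosh y := by linarith [Real.cosh_pos y]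
  have hexp : 0 < Real.exp |y| := Real.exp_pos _
  rw [div_le_iff₀ hpos, Real.exp_neg, ← div_eq_mul_inv, div_mul_eq_mul_div, le_div_iff₀ hexp, one_mul]
  -- `exp|y| ≤ 2 (1 + cosh y)`
  linarith [Real.cosh_pos y]

variable {Λ : Type*} [LinearOrder Λ] [Fintype Λ] {L : ℕ} [NeZero L]

/-- **The zero-mode weight relative to the aligned history.** In the setting of
`norm_trace_prod_gibbsWeight_bdgTorus_phase_le_explicit`, for ANY finite set `G` of modes on which the
explicit stiffness is at least `κ_G` and the dispersion `E_k` at least `E_G`: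
`‖W(θ)‖ ≤ ‖W(0)‖ · (e^{-(κ_G/2)·S(θ)} + 2e^{-(2n+2)|a|E_G})^{|G|}`. [folklore] -/
theorem norm_trace_prod_gibbsWeight_bdgTorus_phase_le_aligned_mul_pow (e : Λ ≃ TorusSite 2 L)
    (η Δv : TorusSite 2 L → ℂ) (hη : ∀ r, η (-r) = η r) (hΔ : ∀ r, Δv (-r) = Δv r) (μ a : ℝ)
    (hreal : ∀ k, star (torusFourier (fun r => η r - if r = 0 then (μ : ℂ) else 0) k) =
      torusFourier (fun r => η r - if r = 0 then (μ : ℂ) else 0) k)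
    (G : Finset (TorusSite 2 L)) (κG EG : ℝ)
    (hκG : ∀ k ∈ G, κG ≤ Real.exp (-(2 * |a| * Real.sqrt ((torusFourier (fun r => η r - if r = 0 then (μ : ℂ)
        else 0) k).re ^ 2 + ‖torusFourier Δv k‖ ^ 2))) *
      min (Real.exp (-(2 * |a| * Real.sqrt ((torusFourier (fun r => η r - if r = 0 then (μ : ℂ)
        else 0) k).re ^ 2 + ‖torusFourier Δv k‖ ^ 2)))) (a ^ 2 * ‖torusFourier Δv k‖ ^ 2) / 4)
    (hEk : ∀ k ∈ G, EG ≤ Real.sqrt ((torusFourier (fun r => η r - if r = 0 then (μ : ℂ) else 0) k).re ^ 2 +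
        ‖torusFourier Δv k‖ ^ 2))
    {n : ℕ} (θ : Fin (2 * n + 2) → ℝ) :
    ‖((List.ofFn fun t => Matrix.gibbsWeight a
        (bdgBondHamiltonian (fun u v => η (e u - e v))
          (fun u v => Complex.exp (Complex.I * θ t) * (-(1 / 2 : ℂ) * star (Δv (e u - e v)))) μ)).prod).trace‖ ≤
      ‖((List.ofFn fun _ : Fin (2 * n + 2) => Matrix.gibbsWeight a
        (bdgBondHamiltonian (fun u v => η (e u - e v))
          (fun u v => Complex.exp (Complex.I * (0 : ℝ)) * (-(1 / 2 : ℂ) * star (Δv (e u - e v)))) μ)).prod).trace‖ *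
        (Real.exp (-(κG / 2 * ∑ t : Fin (2 * n + 2), (1 - Real.cos (θ (t + 1) - θ t)))) +
          2 * Real.exp (-((2 * n + 2) * |a| * EG))) ^ G.card := by
  -- the aligned weight in closed form
  have hal := trace_prod_gibbsWeight_bdgTorus_const_phase e η Δv hη hΔ μ a hreal (m := 2 * n + 1) 0
  have hal' : ‖((List.ofFn fun _ : Fin (2 * n + 2) => Matrix.gibbsWeight a
        (bdgBondHamiltonian (fun u v => η (e u - e v))
          (fun u v => Complex.exp (Complex.I * (0 : ℝ)) * (-(1 / 2 : ℂ) * star (Δv (e u - e v)))) μ)).prod).trace‖ =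
      ‖Complex.exp (-(a : ℂ) * ∑ _t : Fin (2 * n + 2), ∑ _x : Λ, (η 0 - μ))‖ *
        ∏ k : TorusSite 2 L, (2 + 2 * Real.cosh ((2 * n + 2) * a *
            Real.sqrt ((torusFourier (fun r => η r - if r = 0 then (μ : ℂ) else 0) k).re ^ 2 +
              ‖torusFourier Δv k‖ ^ 2))) := by
    rw [hal, norm_mul, norm_prod]
    congr 1
    refine Finset.prod_congr rfl fun k _ => ?_
    rw [Complex.norm_real, Real.norm_eq_abs, abs_of_pos (by positivity)]
    push_cast
    ring_nf
  rw [hal', mul_assoc]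
  refine (norm_trace_prod_gibbsWeight_bdgTorus_phase_le_explicit e η Δv hη hΔ μ a hreal θ).trans ?_
  refine mul_le_mul_of_nonneg_left ?_ (norm_nonneg _)
  -- split the product over the good set `G`
  set S : ℝ := ∑ t : Fin (2 * n + 2), (1 - Real.cos (θ (t + 1) - θ t)) with hS
  have hS0 : 0 ≤ S := Finset.sum_nonneg fun t _ => by linarith [Real.cos_le_one (θ (t + 1) - θ t)]
  refine prod_le_prod_mul_pow_card Finset.univ G (Finset.subset_univ G) _ _ (fun k _ => by positivity)
    (fun k _ => two_add_two_mul_mul_le (Real.cosh_pos _).le ?_) (fun k hk => ?_)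
  · -- `e^{-(κ₀/2) S} ≤ 1`
    rw [Real.exp_le_one_iff, neg_nonpos]
    positivity
  · -- on `G`: `2 + 2C x ≤ (2+2C)(x + 1/(1+C)) ≤ (2+2C)(X + P)`
    refine (two_add_two_mul_mul_le_mul_add (Real.cosh_pos _).le (Real.exp_nonneg _)).trans ?_
    refine mul_le_mul_of_nonneg_left (add_le_add ?_ ?_) (by positivity)
    · -- stiffness monotonicity
      rw [Real.exp_le_exp, neg_le_neg_iff]
      exact mul_le_mul_of_nonneg_right (by linarith [hκG k hk]) hS0
    · -- leakage: `1/(1+cosh((2n+2)aE_k)) ≤ 2e^{-(2n+2)|a|E_G}`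
      refine (one_div_one_add_cosh_le _).trans ?_
      refine mul_le_mul_of_nonneg_left ?_ (by norm_num)
      rw [Real.exp_le_exp, neg_le_neg_iff, abs_mul, abs_mul, abs_of_nonneg (by positivity : (0 : ℝ) ≤ 2 * n + 2),
        abs_of_nonneg (Real.sqrt_nonneg _)]
      exact mul_le_mul_of_nonneg_left (hEk k hk) (by positivity)

end Ratio

end BirBdG

end Summit.HubbardSuperconductivity.HubbardSuperconductivity.Theorems
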